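import Mathlib
import HarnessLib.Audit
import Summits.PneNP.PneNP.Theorems.PstarGConstraint
import Summits.PneNP.PneNP.Theorems.PstarGapPeeling

/-!
# Row reduction of G-constraint systems at a free variable (ROUND-24, normalisation for `|W| ≥ 2`, G-constraint form)

FRONTIER range-avoidance ladder, rung F-N3, ROUND 24 (cell `pnp-ideate`; restricted-model proof complexity — nothing here bears
on `P` versus `NP`).

The G-constraint version of `PstarGapFreeVar` (needed once readers have been substituted, `PstarReaderCore` /
`PstarReaderCoreSystem`, after which the constraints are G-constraints `gval I C G z = b` and the first tip of a "split" reader is a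
free variable of the core system — memo ROUND-24-PRESEED §13 R10(v): "a split reader leaves a free variable, the constraints merge,
`h` drops").  A system is a finite set of triples `(C, G, b)`.  Sums of G-constraints are G-constraints (`gval_symmDiff`), so one can
pivot every constraint containing a variable `v` on a fixed one `(C₀, G₀, b₀) ∋ v` and delete the pivot (`elimG`): the solution set
is unchanged given the pivot (`gsat_iff_elimG`), the new system does not mention `v` in its linear parts, and if `v` is read by no
output of `J` and is no AND slot of a monomial of the system then `J` is solvable with the system iff it is solvable with the reduced
one (`solves_iff_elimG`) — one constraint fewer (`card_elimG_lt`).  Applied to `J` and to every `J ∖ {j}` this transports minimal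
infeasibility.
-/

set_option linter.dupNamespace false

open Finset Literature.Computability.Complexity
open scoped symmDiff
open Summit.PneNP.PneNP.Theorems.PstarPDT (parity)
open Summit.PneNP.PneNP.Theorems.PstarSALevel (varSet)
open Summit.PneNP.PneNP.Theorems.PstarGapPeeling (eval_update_of_not_mem)
open Summit.PneNP.PneNP.Theorems.PstarFibrePolys (bit bit_xor bit_injective)
open Summit.PneNP.PneNP.Theorems.PstarGraphQuadGapTwoForms (sum_symmDiff_zmod2)
open Summit.PneNP.PneNP.Theorems.PstarGapOneAll (gval)
open Summit.PneNP.PneNP.Theorems.PstarGConstraint (bit_gval gval_update_of_forall_ne)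

namespace Summit.PneNP.PneNP.Theorems.PstarGSystemFreeVar

variable {n m : ℕ}

/-- **Sums of G-constraints**: `gval (C △ C') (G △ G') = gval C G ⊕ gval C' G'`. -/
theorem gval_symmDiff (I : LocalMap 4 n m) (C C' : Finset (Fin n)) (G G' : Finset (Fin m)) (z : Fin n → Bool) :
    gval I (C ∆ C') (G ∆ G') z = xor (gval I C G z) (gval I C' G' z) := by
  classical
  apply bit_injective
  rw [bit_xor, bit_gval, bit_gval, bit_gval, sum_symmDiff_zmod2, sum_symmDiff_zmod2]
  ring

/-! ## Pivoting -/

/-- Pivot the constraint `w` on `w₀` at `v`: add `w₀` to `w` if the linear part of `w` contains `v`. -/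
def pivotG (v : Fin n) (w₀ w : Finset (Fin n) × Finset (Fin m) × Bool) : Finset (Fin n) × Finset (Fin m) × Bool :=
  if v ∈ w.1 then (w.1 ∆ w₀.1, w.2.1 ∆ w₀.2.1, xor w.2.2 w₀.2.2) else w

/-- The reduced system: every other constraint pivoted on `w₀` at `v`, the pivot deleted. -/
def elimG (𝒲 : Finset (Finset (Fin n) × Finset (Fin m) × Bool)) (w₀ : Finset (Fin n) × Finset (Fin m) × Bool) (v : Fin n) :
    Finset (Finset (Fin n) × Finset (Fin m) × Bool) :=
  (𝒲.erase w₀).image (pivotG v w₀)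

/-- The reduced system is smaller. -/
theorem card_elimG_lt {𝒲 : Finset (Finset (Fin n) × Finset (Fin m) × Bool)} {w₀ : Finset (Fin n) × Finset (Fin m) × Bool}
    (hw₀ : w₀ ∈ 𝒲) (v : Fin n) : (elimG 𝒲 w₀ v).card < 𝒲.card :=
  card_image_le.trans_lt (card_erase_lt_of_mem hw₀)

/-- A pivoted constraint does not contain `v` in its linear part (when `w₀` does). -/
theorem not_mem_pivotG {v : Fin n} {w₀ : Finset (Fin n) × Finset (Fin m) × Bool} (hv : v ∈ w₀.1)
    (w : Finset (Fin n) × Finset (Fin m) × Bool) : v ∉ (pivotG v w₀ w).1 := by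
  unfold pivotG
  split_ifs with h
  · simp [mem_symmDiff, h, hv]
  · exact h

/-- Linear parts of the reduced system avoid `v`. -/
theorem not_mem_of_mem_elimG {𝒲 : Finset (Finset (Fin n) × Finset (Fin m) × Bool)} {w₀ : Finset (Fin n) × Finset (Fin m) × Bool}
    {v : Fin n} (hv : v ∈ w₀.1) {w : Finset (Fin n) × Finset (Fin m) × Bool} (hw : w ∈ elimG 𝒲 w₀ v) : v ∉ w.1 := by
  classical
  obtain ⟨w', -, rfl⟩ := mem_image.1 hw
  exact not_mem_pivotG hv w'

/-- Monomial sets of the reduced system lie in the union of the old ones. -/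
theorem monomials_elimG {𝒲 : Finset (Finset (Fin n) × Finset (Fin m) × Bool)} {w₀ : Finset (Fin n) × Finset (Fin m) × Bool}
    (hw₀ : w₀ ∈ 𝒲) {v : Fin n} {w : Finset (Fin n) × Finset (Fin m) × Bool} (hw : w ∈ elimG 𝒲 w₀ v) {g : Fin m} (hg : g ∈ w.2.1) :
    ∃ w' ∈ 𝒲, g ∈ w'.2.1 := by
  classical
  obtain ⟨w', hw', rfl⟩ := mem_image.1 hw
  unfold pivotG at hg
  split_ifs at hg with h
  · rcases mem_symmDiff.1 hg with ⟨h1, -⟩ | ⟨h1, -⟩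
    · exact ⟨w', mem_of_mem_erase hw', h1⟩
    · exact ⟨w₀, hw₀, h1⟩
  · exact ⟨w', mem_of_mem_erase hw', hg⟩

/-- Given `w₀`, a pivoted constraint holds iff the original one does. -/
theorem gval_pivotG_iff (I : LocalMap 4 n m) {v : Fin n} {w₀ : Finset (Fin n) × Finset (Fin m) × Bool} {z : Fin n → Bool}
    (hz₀ : gval I w₀.1 w₀.2.1 z = w₀.2.2) (w : Finset (Fin n) × Finset (Fin m) × Bool) :
    gval I (pivotG v w₀ w).1 (pivotG v w₀ w).2.1 z = (pivotG v w₀ w).2.2 ↔ gval I w.1 w.2.1 z = w.2.2 := by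
  unfold pivotG
  split_ifs
  · simp only [gval_symmDiff, hz₀]
    cases gval I w.1 w.2.1 z <;> cases w.2.2 <;> cases w₀.2.2 <;> simp
  · exact Iff.rfl

/-- **Row reduction preserves the solution set**: the system holds iff the reduced system and the pivot hold. -/
theorem gsat_iff_elimG (I : LocalMap 4 n m) {𝒲 : Finset (Finset (Fin n) × Finset (Fin m) × Bool)}
    {w₀ : Finset (Fin n) × Finset (Fin m) × Bool} (hw₀ : w₀ ∈ 𝒲) (v : Fin n) (z : Fin n → Bool) :
    (∀ w ∈ 𝒲, gval I w.1 w.2.1 z = w.2.2) ↔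
      (∀ w ∈ elimG 𝒲 w₀ v, gval I w.1 w.2.1 z = w.2.2) ∧ gval I w₀.1 w₀.2.1 z = w₀.2.2 := by
  classical
  unfold elimG
  constructor
  · intro h
    have h0 := h w₀ hw₀
    refine ⟨fun w' hw' => ?_, h0⟩
    obtain ⟨w, hw, rfl⟩ := mem_image.1 hw'
    exact (gval_pivotG_iff I h0 w).2 (h w (mem_of_mem_erase hw))
  · rintro ⟨h, h0⟩ w hw
    by_cases hww : w = w₀
    · subst hww; exact h0
    · exact (gval_pivotG_iff I h0 w).1 (h _ (mem_image_of_mem _ (mem_erase.2 ⟨hww, hw⟩)))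

/-! ## Free variables -/

/-- **Solvability is unchanged by reducing at a free variable.**  If `v ∈ C₀` is read by no output of `J` and is no monomial slot
of the system, then `J` is solvable with the system iff it is solvable with the reduced system (flip `v` to fix the pivot). -/
theorem solves_iff_elimG (I : LocalMap 4 n m) (y : Fin m → Bool) {𝒲 : Finset (Finset (Fin n) × Finset (Fin m) × Bool)}
    {J : Finset (Fin m)} {w₀ : Finset (Fin n) × Finset (Fin m) × Bool} (hw₀ : w₀ ∈ 𝒲) {v : Fin n} (hv : v ∈ w₀.1)
    (hvJ : ∀ j ∈ J, v ∉ varSet I j) (hvG : ∀ w ∈ 𝒲, ∀ g ∈ w.2.1, I.vars g 2 ≠ v ∧ I.vars g 3 ≠ v) :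
    (∃ z : Fin n → Bool, (∀ j ∈ J, I.eval z j = y j) ∧ ∀ w ∈ 𝒲, gval I w.1 w.2.1 z = w.2.2) ↔
      ∃ z : Fin n → Bool, (∀ j ∈ J, I.eval z j = y j) ∧ ∀ w ∈ elimG 𝒲 w₀ v, gval I w.1 w.2.1 z = w.2.2 := by
  classical
  constructor
  · rintro ⟨z, hzJ, hz𝒲⟩
    exact ⟨z, hzJ, ((gsat_iff_elimG I hw₀ v z).1 hz𝒲).1⟩
  · rintro ⟨z, hzJ, hz𝒲⟩
    by_cases h0 : gval I w₀.1 w₀.2.1 z = w₀.2.2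
    · exact ⟨z, hzJ, (gsat_iff_elimG I hw₀ v z).2 ⟨hz𝒲, h0⟩⟩
    · -- flip `v`: outputs of `J` and the reduced system are untouched, the pivot gets fixed
      refine ⟨Function.update z v (!z v), fun j hj => by rw [eval_update_of_not_mem I j z (hvJ j hj)]; exact hzJ j hj,
        (gsat_iff_elimG I hw₀ v _).2 ⟨fun w hw => ?_, ?_⟩⟩
      · rw [gval_update_of_forall_ne I z (not_mem_of_mem_elimG hv hw) (fun g hg => ?_)]
        · exact hz𝒲 w hw
        · obtain ⟨w', hw', hg'⟩ := monomials_elimG hw₀ hw hg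
          exact hvG w' hw' g hg'
      · -- the pivot toggles
        have htog : gval I w₀.1 w₀.2.1 (Function.update z v (!z v)) = !gval I w₀.1 w₀.2.1 z := by
          have hsplit : ∀ f : Fin n → Bool, ∑ u ∈ w₀.1, bit (f u) = bit (f v) + ∑ u ∈ w₀.1.erase v, bit (f u) := fun f =>
            (add_sum_erase _ _ hv).symm
          have hrest : ∑ u ∈ w₀.1.erase v, bit (Function.update z v (!z v) u) = ∑ u ∈ w₀.1.erase v, bit (z u) :=
            sum_congr rfl fun u hu => by rw [Function.update_of_ne (ne_of_mem_erase hu)]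
          have hmon : ∑ g ∈ w₀.2.1, bit (Function.update z v (!z v) (I.vars g 2)) * bit (Function.update z v (!z v) (I.vars g 3)) =
              ∑ g ∈ w₀.2.1, bit (z (I.vars g 2)) * bit (z (I.vars g 3)) :=
            sum_congr rfl fun g hg => by
              rw [Function.update_of_ne (hvG w₀ hw₀ g hg).1, Function.update_of_ne (hvG w₀ hw₀ g hg).2]
          have hb : ∀ c : Bool, bit (!c) = bit c + 1 := by decide
          apply bit_injective
          rw [hb, bit_gval, bit_gval, hsplit (Function.update z v (!z v)), hsplit z, Function.update_self, hrest, hmon, hb]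
          ring
        rw [htog]
        revert h0
        cases gval I w₀.1 w₀.2.1 z <;> cases w₀.2.2 <;> simp

end Summit.PneNP.PneNP.Theorems.PstarGSystemFreeVar
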